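import Summits.CriticalPhenomena.PercolationContinuityZ3.Theorems.Transplant.SkelPhiFaceKitsN
import Summits.CriticalPhenomena.PercolationContinuityZ3.Theorems.Transplant.SkelPhiFaceDataNbHistT
import Summits.CriticalPhenomena.PercolationContinuityZ3.Theorems.Transplant.SkelPhiFaceDataNbHist
import Summits.CriticalPhenomena.PercolationContinuityZ3.Theorems.Transplant.SkelPhiFaceKitsRunNb
import Literature.Probability.Percolation.OrientedHistorySiteRenormalizationRun
import Summits.CriticalPhenomena.PercolationContinuityZ3.Theorems.Transplant.SkelPhiFaceDataNT
import Summits.CriticalPhenomena.PercolationContinuityZ3.Theorems.Transplant.SkelPhiFaceDataNbT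
import Summits.CriticalPhenomena.PercolationContinuityZ3.Theorems.Transplant.PlanarCells2TDefs
import HarnessLib
/-!
(R-40) SUCCESSOR `…T` (hp-8 g42, 2026-08-23; ruling p3-g16 06:23:56Z, J18): the twin of `SkelPhiFaceKitsRunNbS` over the PER-AXIS creep cap `PCells2T` (PlanarCells2TDefs:
`c i ≤ r (oth i)` instead of the uniform `c i ≤ cmax ≤ r j`); statements and proofs VERBATIM with `PCells2S ↦ PCells2T` (+ the renames of record of the T layer below it);
the only mathematical touch points are the places that read the cap, which only ever need the cross form `c (oth j) ≤ r j` (listed in the lane line of this file's landing).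
NO landed file is edited; `SkelPhiFaceKitsRunNbS` stays valid (and is an instance of this file through `PCells2S.toT`). NON-VACUITY: inherited verbatim from `SkelPhiFaceKitsRunNbS` (same witness line).

# N2 (frames-only node `SamePDropOfSkeletonFrm₁`, OPEN) — WAVE 1, (F) face-data column over STAGGERED cells ((R-22) `PCells2T`, (R-28)(β) one landing per file): the twin of N1's `SkelPhiFaceKitsRunNb`

builds on p205010 (kernel theorem, internal audit signed; external expert review pending) — nothing in this file uses p205010; NOTHING is claimed about the
open node `SamePDropOfSkeletonFrm₁` (`SamePDropOfSkeletonNeg₁` is CLOSED in the tree and untouched by this file).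
Status sentence (coordinator 2026-08-20T04:30Z): "θ(p_c) = 0 on ℤ^d, all d ≥ 2 — kernel-verified (Lean 4/Mathlib, standard axioms); internal adversarial
audit SIGNED 2026-08-20 04:29Z; external expert review pending."
Lane `prim-bschramm`, seat `prim-hp-8` (gen 40); helper file (`--supports stmt-CriticalPhenomena-4575 --as helper`); design owner p3-g15 ((R-22) staggered
cells `PCells2T`, (R-27)/(R-29) far regions of record `FarNS/FarNS₂`, (R-28)(β), naming 2026-08-22T23:00:04Z: suffix `S`).
PORT RULES (HOME/prim-hp-8/code/gen40/orient/bin/port_s.py = stmt-g19's port_orient.py + the G token table): the cells are `P : PCells2T`, every box is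
read about the STAGGERED centre `cenS` (`PlanarCells2SDefs/SFar/ContainS/SArm/SepS/SepInfS/LevelsS/EfarN2S`), the scheme record is `cellGeomSG₂T`/`cellGeomSG₂bT`
(`SkelPhiCellsWeakGS/…SmallMS`: narrow arm `BtwNS`, two-block far region `FarNS₂`), the history-site API is the ORIENTED one at `qNE` where it occurs
(`ochoice qNE`, `onwardO`, `Valid₂O`, `IsRun₂O`, …, (R-18)); EVERY declaration is re-declared with the suffix `S` (same namespace). Docstrings/citations are N1's.
N1 HEADER (kept for the reader):
* `winLevel_subset_stepRg_faceStepWNb` (levels `j′ ≤ Rlev + 1` lie in the region), `far_mem_faceStepWNb_T` (far part of a level lies in the rim),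
  **`hkits_faceStepWNb`**.
[cite: KozmaNitzan2024, §4 Lemma 10, Steps III–IV (pp. 19–21); p. 30 (Step III)] [cite: MartineauTassion2017, §4.3 Lemma 4.2]
-/
noncomputable section

open scoped Classical

namespace Summit.CriticalPhenomena.PercolationContinuityZ3.Theorems.Transplant

namespace Skelφ

open MeasureTheory
open Literature.Probability.Percolation Literature.Probability.LatticeModels SimpleGraph KNLevels
open Literature.Barriers.CriticalPhenomena (graphBall graphBall_finite mem_graphBall_self graphBall_mono)
open Skel (winGraph winGraph_adj winGraph_le KitGeom WinStepData)
open SkelI (tanOff tanTgt tanTgt_mem)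
open Literature.Probability.Percolation.KozmaNitzan.Cells (oth oth_ne eq_oth_of_ne oth_oth)
open BoxProdZ2 (ConcRadiiG)

variable {V : Type} [DecidableEq V] {G : SimpleGraph V} [G.LocallyFinite] {φ : V → Site 2}

/-! ## §1 Levels inside the region; the far part of a level inside the rim -/

section Geometry

variable (G) (pr : FinePrm) (φ) (P : PCells2T) (w₀ : V) (Λ : ConcRadiiG) (b₀ : Fin 2 → ℕ) (b : Fin 2)
variable (a' : ℕ) (x : Site 2) (du : MDir) (j : ℕ) (pc : ℤ) (aw Rlev N M L' : ℕ) (Sfin : Finset V)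

variable {pr b x du j pc aw Rlev} in
/-- **Levels `j′ ≤ Rlev + 1` of the face frame lie in the region** (`faceStepWNb_enclT`). [cite: KozmaNitzan2024, §4 Lemma 10 (p. 17: X_{R+1} ⊆ D)] -/
theorem winLevel_subset_stepRg_faceStepWNbT {yF : V} (hyF : pr.ψ φ w₀ yF = P.faceCen x du j) (hpc : pc = relφ φ w₀ yF b)
    (hj : j + 1 ≤ P.K) (hRlev : Rlev + 4 ≤ 10 * P.s du.1) (hRlev' : (Rlev : ℤ) + 5 + P.c du.1 ≤ 3 * P.r (oth du.1)) (hc₀ : 0 < pr.c₀) (hc₁ : 0 < pr.c₁)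
    (hD : 0 < pr.D) (hnz : pr.lvGen du.1 b ≠ 0) {kF : ℤ}
    (hroom : pr.Mabs * (aw + Rlev + 1) + pr.rdN du.1 b * (Rlev + 2) * pr.D ≤ pr.rdK du.1 b * kF * pr.D) (hkF : kF + 3 + P.c du.1 ≤ 5 * P.r (oth du.1))
    {j' : ℕ} (hj' : j' ≤ Rlev + 1) :
    winLevel G (pr.frame φ w₀ du.1 b) w₀ (Λ.rE a' x du) (loNT P x du j pc aw) (hiNT P x du j pc aw) j' ⊆
      stepRg G (pr.frame φ w₀ du.1 b) (faceStepWNbT G pr φ P w₀ Λ b₀ b a' x du j pc aw Rlev N M L' Sfin) := by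
  have hencl : Finset.Icc (loNT P x du j pc aw - ((Rlev + 1 : ℕ) : Site 2)) (hiNT P x du j pc aw + ((Rlev + 1 : ℕ) : Site 2)) ⊆
      DplNT G pr φ P w₀ Λ b a' x du j pc aw Rlev :=
    faceStepWNb_enclT G φ P w₀ Λ b₀ a' hyF hpc hj hRlev hRlev' hc₀ hc₁ hD hnz hroom hkF N M L' Sfin
  have hIcc : Finset.Icc (loNT P x du j pc aw - ((j' : ℕ) : Site 2)) (hiNT P x du j pc aw + ((j' : ℕ) : Site 2)) ⊆
      Finset.Icc (loNT P x du j pc aw - ((Rlev + 1 : ℕ) : Site 2)) (hiNT P x du j pc aw + ((Rlev + 1 : ℕ) : Site 2)) := by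
    refine Finset.Icc_subset_Icc (fun i => ?_) (fun i => ?_) <;> simp only [Pi.sub_apply, Pi.add_apply, Pi.natCast_apply] <;> push_cast <;> omega
  intro v hv
  rw [faceStepWNb_RgT, mem_Win]
  rw [winLevel, mem_Win] at hv
  exact ⟨hv.1, hencl (hIcc hv.2)⟩

/-- **The far part of a level lies in the target's rim**: a vertex of the region outside `B(w₀, rE − r₀)` lies in `T` once `rM − L' + r₀ ≤ rE`.
[cite: KozmaNitzan2024, §4 Lemma 10 Step IV (far contacts)] -/
theorem far_mem_faceStepWNb_TT {r₀ : ℕ} (hrim : Λ.rM a' (x + stepVec du) - L' + r₀ ≤ Λ.rE a' x du) {v : V}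
    (hv : v ∈ stepRg G (pr.frame φ w₀ du.1 b) (faceStepWNbT G pr φ P w₀ Λ b₀ b a' x du j pc aw Rlev N M L' Sfin))
    (hfar : v ∉ graphBall G w₀ (Λ.rE a' x du - r₀)) : v ∈ (faceStepWNbT G pr φ P w₀ Λ b₀ b a' x du j pc aw Rlev N M L' Sfin).T := by
  rw [faceStepWNb_TT]
  refine Finset.mem_union_right _ (Finset.mem_filter.2 ⟨hv, fun hb => hfar (graphBall_mono G w₀ (by omega) hb)⟩)

end Geometry

/-! ## §2 The kit clause of one level of the face step -/

/-- **THE KIT CLAUSE OF LEVEL `j′ ∈ [M+1, Rlev]` OF THE FACE STEP `faceStepWNbT`** (the `hkits` hypothesis of `faceOblRM_fineNbT` at one level), from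
the inputs at every centre (zone, short exit links of `pexF`) and a route at every centre of the `E`-enlarged level box inside `B(w₀, rE − r)`.
[cite: KozmaNitzan2024, §4 Lemma 10 (pp. 17–21), p. 30 (Step III)] [cite: MartineauTassion2017, §4.3 Lemma 4.2] -/
theorem hkits_faceStepWNbT [Countable V] {types : Finset V} (hlipφ : Lip G φ) (hstep : Steps G φ) (hfr : Frames G φ types)
    (hκ : CylConn G φ types) {Δ : ℕ} (hΔ : ∀ v, G.degree v ≤ Δ) {q : unitInterval} {δ : ℝ} (hδ : 0 < δ)
    -- the face frame at the window centre
    (pr : FinePrm) (w₀ : V) (du : MDir) (b : Fin 2) (hc₀ : 0 < pr.c₀) (hc₁ : 0 < pr.c₁) (hD : 0 < pr.D) (hL0 : pr.c₀ * pr.L 0 ≤ pr.D)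
    (hL1 : pr.c₁ * pr.L 1 ≤ pr.D) (hA0 : 0 < pr.A) (hn : 0 ≤ pr.n) (hb : |pr.lvGen du.1 (oth b)| ≤ |pr.lvGen du.1 b|)
    (hnz : pr.lvGen du.1 b ≠ 0) {nF : ℕ} (hnC : (nF : ℤ) ≤ pr.cOf du.1 * |pr.A| * |pr.lvGen du.1 b|) (hU3 : pr.D ≤ 3 * (nF : ℤ))
    {e f : ℤ} (he : e = 1 ∨ e = -1) (hf : f = 1 ∨ f = -1) (hev : e * pr.vβ = |pr.vβ|) (hfv : f * pr.vα = |pr.vα|)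
    -- the face step
    (P : PCells2T) (Λ : ConcRadiiG) (b₀ : Fin 2 → ℕ) (a' : ℕ) (x : Site 2) (j : ℕ) (pc : ℤ) (aw Rlev N M L' : ℕ) (Sfin : Finset V)
    {yF : V} (hyF : pr.ψ φ w₀ yF = P.faceCen x du j) (hpc : pc = relφ φ w₀ yF b) (hjK : j + 1 ≤ P.K) (hRlev : Rlev + 4 ≤ 10 * P.s du.1)
    (hRlev' : (Rlev : ℤ) + 5 + P.c du.1 ≤ 3 * P.r (oth du.1)) {kF : ℤ}
    (hroomF : pr.Mabs * (aw + Rlev + 1) + pr.rdN du.1 b * (Rlev + 2) * pr.D ≤ pr.rdK du.1 b * kF * pr.D) (hkF : kF + 3 + P.c du.1 ≤ 5 * P.r (oth du.1))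
    {j' : ℕ} (hj'M : M + 1 ≤ j') (hj'R : j' ≤ Rlev)
    -- kit constants
    (PA : ApronPrm) {nz Rs Kmax KCmax rs cS cU E r : ℕ} (hPN : 3 ≤ PA.N) (hA : PA.A = (nz + 1 : ℕ) * pr.D + 1)
    (hd1 : PA.W + PA.ℓ ≤ PA.d) (hD1 : PA.W + PA.ℓ + PA.d + 2 ≤ shellD PA) (hD2 : PA.ℓ + Rs + PA.d + 3 ≤ shellD PA) (hDρ : Rs + 1 ≤ shellD PA)
    (hℓ : 1 ≤ PA.ℓ) (hW : Rs + PA.ℓ ≤ PA.W) (hKmax : (shellD PA + PA.W) * 3 ≤ Kmax) (hKCmax : (shellD PA + nz + 1) * 3 ≤ KCmax)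
    (hR' : cylRadMax G φ types PA.ℓ (Rs + KCmax + (PA.W + Kmax)) ≤ PA.R')
    (hMtan : tanOff PA.ℓs PA.M ≤ (M : ℤ) + 1) (hMd : PA.d + 2 ≤ 2 * M + 2) (hMD : shellD PA + 1 + PA.d + KCmax + Rs ≤ 2 * M + 2)
    (hT : (PA.W : ℤ) + Kmax + PA.ℓ + 1 ≤ tanOff PA.ℓs PA.M) (hT' : (shellD PA : ℤ) + KCmax + Rs ≤ tanOff PA.ℓs PA.M)
    (hr₀ : PA.N * (tanOff PA.ℓs PA.M + 2) + PA.N * PA.d + (PA.W + Kmax + PA.R') + (KCmax + Rs) ≤ PA.r₀) (hR : PA.r₀ ≤ Λ.rE a' x du)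
    (hrs : 2 * (1 + PA.N * (tanOff PA.ℓs PA.M + 2) + PA.N * PA.d + (PA.W + Kmax + PA.R') + (KCmax + Rs)) ≤ rs)
    (hcS : (PA.N + 1) * (tanOff PA.ℓs PA.M + 1) + (PA.N + 1) * PA.d + (2 * PA.W + 1) * (Kmax + 1) * (Δ + 1) ^ PA.R' ≤ cS)
    (hE : Rlev + (PA.N * (tanOff PA.ℓs PA.M + 1) + PA.N * PA.d + KCmax) ≤ E)
    (hreach : r + (PA.N * (tanOff PA.ℓs PA.M + 1) + PA.N * PA.d + KCmax) ≤ PA.r₀)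
    (hrim : Λ.rM a' (x + stepVec du) - L' + PA.r₀ ≤ Λ.rE a' x du)
    -- the short region, the zone family, the short pieces and their rooms
    (Rg : V → Finset V) (hRg : ∀ c, ∀ u ∈ Rg c, u ∈ graphBall G c Rs) (hRgcard : ∀ c, (Rg c).card ≤ cU) (hcU1 : 1 ≤ cU)
    (Λc : V → ℕ → Finset V) (kz : ℕ) (hkn : ∀ c, Λc c kz ⊆ Λc c nz) (hΛ : ∀ c, ∀ v ∈ Λc c nz, v ∈ Rg c ∧ φ v - φ c ∈ box 2 nz)
    (QS : ShortPc V) (hQRg : ∀ i σ₀ c, FinePrm.pexF G φ du.1 b QS e f i σ₀ c ⊆ Rg c) (hnS : ∀ c, 1 ≤ QS.nS c) {kβ k₁ k₀ : ℤ}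
    (hexα : b = 0 → ∀ c, PA.A + 2 * pr.D ≤ (QS.nS c : ℤ) * pr.D)
    (hexβ : b = 1 → PA.A + 2 * pr.D ≤ kβ * pr.D ∧
      ∀ c, kβ * QS.nS c ≤ (QS.nS c : ℤ) * QS.ℓS c - (shearUnit (QS.nS c) (QS.hS c) : ℤ) + 1 - |QS.hS c| * QS.nS c)
    (hex₁ : du.1 = 1 → PA.A + pr.climC 1 b 1 + pr.D ≤ k₁ * pr.D ∧ ∀ c, (k₁ + 1) * pr.D * QS.nS c ≤
      pr.c₁ * (pr.A * (pr.n * ((QS.nS c : ℤ) * QS.ℓS c - (shearUnit (QS.nS c) (QS.hS c) : ℤ) + 1) - |pr.n * QS.hS c - pr.h * QS.nS c| * QS.nS c)))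
    (hex₀ : du.1 = 0 → PA.A + pr.climC 0 b 0 + pr.D ≤ k₀ * pr.D ∧ ∀ c, (k₀ + 1) * pr.D ≤ pr.c₀ * (pr.A * (|pr.vβ| * QS.nS c - |pr.vα| * |QS.hS c|)))
    -- the weighting: a subbox weighting of the window graph on the region
    (kk : ℕ) {Wt : Sym2 V → unitInterval}
    (hWD : IsSubbox (winGraph G w₀ (Λ.rE a' x du)) Wt q
      (stepRg G (pr.frame φ w₀ du.1 b) (faceStepWNbT G pr φ P w₀ Λ b₀ b a' x du j pc aw Rlev N M L' Sfin)))
    (hN : kk * (Δ + 1) ^ (2 * rs) ≤ N) (hk : (1 - (q : ℝ) ^ (1 + Δ * cS + cS * cU)) ^ kk ≤ δ)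
    -- THE INPUTS AT EVERY CENTRE and THE ROUTE at every centre of the enlarged box near the window centre
    (hzone : ∀ c, 1 - δ ^ 2 < (bondPercolation G q).real (UniqZone.zone G (Λc c) kz nz))
    (hexit : ∀ c (i : Fin 2) (σ₀ : ℤˣ), 1 - δ ^ 2 < (bondPercolation G q).real
      (linkIn (↑(Rg c) : Set V) (Λc c kz) (FinePrm.pexF G φ du.1 b QS e f i σ₀ c)))
    (hroute : ∀ c, pr.frame φ w₀ du.1 b c ∈ Finset.Icc (loNT P x du j pc aw - ((E : ℕ) : Site 2)) (hiNT P x du j pc aw + ((E : ℕ) : Site 2)) →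
      c ∈ graphBall G w₀ (Λ.rE a' x du - r) →
      ∃ Qt Ft : Finset V, Ft ⊆ (faceStepWNbT G pr φ P w₀ Λ b₀ b a' x du j pc aw Rlev N M L' Sfin).T ∧
        Qt ⊆ stepRg G (pr.frame φ w₀ du.1 b) (faceStepWNbT G pr φ P w₀ Λ b₀ b a' x du j pc aw Rlev N M L' Sfin) ∧ Disjoint Ft (Λc c nz) ∧
        1 - δ ^ 2 < (prodBernoulli Wt).real (linkIn (↑Qt : Set V) (Λc c kz) Ft)) :
    let Q := faceStepWNbT G pr φ P w₀ Λ b₀ b a' x du j pc aw Rlev N M L' Sfin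
    ∃ (σ : KNLevels.SData V) (Sz : Finset V),
      KNLevels.SHyp (winLData G (pr.frame φ w₀ du.1 b) Q.root Q.Rπ Q.lo Q.hi Q.root Q.Sfin) j' σ ∧ σ.N ≤ Q.N ∧
      (1 - (q : ℝ) ^ σ.sB) ^ σ.k ≤ δ ∧ Sz ⊆ (winLData G (pr.frame φ w₀ du.1 b) Q.root Q.Rπ Q.lo Q.hi Q.root Q.Sfin).X j' ∧
      Sz ⊆ stepRg G (pr.frame φ w₀ du.1 b) Q ∧
      (∀ x' ∈ σ.K, ∀ e' ∈ σ.seed x', e' ∉ wireSet (↑Sz : Set V)) ∧ (∀ x' ∈ σ.K, σ.face x' ⊆ Sz) ∧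
      (∀ x' ∈ σ.K, 1 - 3 * δ ≤ (prodBernoulli Wt).real {ω | ∃ u ∈ σ.face x',
        1 - δ < (prodBernoulli (pinW Wt (wireSet (↑Sz : Set V)) ω)).real
          (⋃ t ∈ Q.T, openConnIn (↑(stepRg G (pr.frame φ w₀ du.1 b) Q) : Set V) u t)}) := by
  intro Q
  -- the wide level box
  have hw := loN_hiN_hwideT P x du j pc aw hj'M
  have hwide : ∀ i, (loNT P x du j pc aw - (j' : Site 2)) i + 2 * tanOff PA.ℓs PA.M ≤ (hiNT P x du j pc aw + (j' : Site 2)) i := fun i => by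
    have := hw i; linarith
  have hMd' : ((PA.d + 2 : ℕ) : ℤ) ≤ 2 * M + 2 := by exact_mod_cast hMd
  have hMD' : ((shellD PA + 1 + PA.d + KCmax + Rs : ℕ) : ℤ) ≤ 2 * M + 2 := by exact_mod_cast hMD
  have hdw : ∀ i, (loNT P x du j pc aw - (j' : Site 2)) i + (PA.d + 2 : ℕ) ≤ (hiNT P x du j pc aw + (j' : Site 2)) i := fun i => by
    have := hw i; linarith
  have hDw : ∀ i, (loNT P x du j pc aw - (j' : Site 2)) i + ((shellD PA + 1 + PA.d + KCmax + Rs : ℕ) : ℤ) ≤ (hiNT P x du j pc aw + (j' : Site 2)) i :=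
    fun i => by have := hw i; linarith
  -- the level inside the region; the far part inside the rim
  have hXD : winLevel G (pr.frame φ w₀ du.1 b) w₀ (Λ.rE a' x du) (loNT P x du j pc aw) (hiNT P x du j pc aw) j' ⊆
      stepRg G (pr.frame φ w₀ du.1 b) Q :=
    winLevel_subset_stepRg_faceStepWNbT G φ P w₀ Λ b₀ a' N M L' Sfin hyF hpc hjK hRlev hRlev' hc₀ hc₁ hD hnz hroomF hkF (by omega)
  have hfarT : ∀ v ∈ winLevel G (pr.frame φ w₀ du.1 b) w₀ (Λ.rE a' x du) (loNT P x du j pc aw) (hiNT P x du j pc aw) j',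
      v ∉ graphBall G w₀ (Λ.rE a' x du - PA.r₀) → v ∈ Q.T := fun v hv hfar =>
    far_mem_faceStepWNb_TT G φ pr P w₀ Λ b₀ b a' x du j pc aw Rlev N M L' Sfin hrim (hXD hv) hfar
  have hE' : j' + (PA.N * (tanOff PA.ℓs PA.M + 1) + PA.N * PA.d + KCmax) ≤ E := le_trans (by omega) hE
  exact hkits_face_of_route hlipφ hstep hfr hκ hΔ hδ pr w₀ du.1 b hc₀.le hc₁.le hD hL0 hL1 (pr.cOf_pos hc₀ hc₁ du.1) hA0 hn hb hnz hnC hU3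
    he hf hev hfv PA hPN hA hd1 hD1 hD2 hDρ hℓ hW hKmax hKCmax hR' hwide hdw hDw hT hT' hr₀ hR hrs hcS hE' hreach Rg hRg hRgcard hcU1 Λc kz hkn
    hΛ QS hQRg hnS hexα hexβ hex₁ hex₀ kk w₀ Sfin hWD hXD hfarT hN hk hzone hexit hroute

end Skelφ

end Summit.CriticalPhenomena.PercolationContinuityZ3.Theorems.Transplant

end
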